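import Summits.ResolutionOfSingularities.ResolutionOfSingularities.Theorems.FrobeniusClosingSteerArithTransportWordsFine
import Summits.ResolutionOfSingularities.ResolutionOfSingularities.Theorems.FrobeniusClosingSteerArithTransportTyping
import Summits.ResolutionOfSingularities.ResolutionOfSingularities.Theorems.FrobeniusClosingSteerEvenTangentialNormalForm
import Mathlib.Algebra.CharP.Subring
import HarnessLib

/-!
# K-β0(b) fine words — the STAGE-`j′` KERNEL shared by (F-AB) and (F-BB) v2: re-cleaning into the FINE class, the unit-coefficient off-line
  obstruction, and unit rescaling of the `e = 2` clause (res-L0-w41-plan-1 RULINGs 318 (d) / 322 (ii); def-free)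

OURS (campaign `res-hironaka`, rung L ★L-G4, slot W4.1 · crux `Steer` (stmt-ResolutionOfSingularities-16345) · K-β0(b) = the tree induction
`ArithTransportFine.arithTransport_of_six_fine_words` p578229 ✓ modulo the six FINE visit words p577210 ✓). Candidates, not facts; nothing here is a
statement of H. Hironakaʼs manuscript [claim: Hironaka2017, status: under-review]; AI-written, AI review is weaker than expert review.

Both forward words (F-AB) `BinaryBConeAfterATwoN` and (F-BB) `BinaryBConeAfterBTwoN` conclude `BinaryBConeE2At R s 2 x′ d j′` — the FINE-CLASS
B-shape along the new divisor `x′` (`= u`, resp. `= x/u`) at the landing stage `j′`. After the transport identities (visit law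
`VisitLawDelta.visitLaw₂_of_run`: `R j′ = R (j+1)`, `s_{j′}·u^((d+1)/2)·W = s_j − G`; `Ψ` homogeneous: `Ψ(n) = u^d·Ψ(n/u)`; `θ₀ ∈ 𝔪^(d−1) ⊆ u^(d−1)·R_{j′}`;
square part by normality) the member at `j′` is presented as `f′ = g₁² + x′·Ψ′(n′) + x′²·θ` with `θ ∈ R_{j′}` ONLY — the fine class wants
`θ ∈ 𝔪′^(d−1)`. res-L0-w41-tri-1 TRIAGE v6.68 (B): the landing hypothesis «cleaned order `d + 1` at `j′`» RE-CLEANS it. This module proves that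
step once, ring-level and in run currency, plus the generic off-line obstruction and the harmless unit rescaling of `Ψ` (the factor `W⁻²`):
* `exists_reclean_fine` — regular local `S` of characteristic `2`, `x ∈ 𝔪 ∖ 𝔪²`, `d` odd, `q ∈ 𝔪^d`, `f = g² + x·q + x²·θ`, `∃ h, f − h² ∈ 𝔪^(d+1)`
  ⇒ `∃ δ, θ − δ² ∈ 𝔪^(d−1) ∧ f − (g + x·δ)² − x·q = x²·(θ − δ²)` (one call to `EvenTangentialNormalForm.exists_normalForm` with `2e = d + 1`,
  `A := q + x·θ`, `B := 0`, then `x·(θ − δ²) = A′ − q ∈ 𝔪^d` and `ord x = 1`).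
* **`binaryBConeE2At_of_presentation`** — run currency: at a stage `j` with `R j` regular, an r.s.o.p.-part `(x, n₁, n₂)`, a form `Ψ` of odd degree
  `d` with the `e = 2` clause, `s j² = g² + x·Ψ(n₁, n₂) + x²·θ` (`θ : R j` arbitrary) and SOME `h` with `s j² − h² ∈ 𝔪^(d+1)` ⇒ `BinaryBConeE2At R s 2 x d j`.
  This is the last line of both (F-AB) and (F-BB) v2 on-line; `…_of_hasCleanedOrderAt` takes the landing hypothesis in word currency.
* `not_sub_sq_mem_sq_of_isUnit` / `not_hasCleanedOrderAt_of_isUnit` — the generic OFF-LINE obstruction: `f = g² + x·A` with `A` a unit and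
  `x ∈ 𝔪 ∖ 𝔪²` has `f − h² ∉ 𝔪²` for every `h`; hence no cleaned order `ν ≥ 2` at such a stage (kills the landing points where `Ψ̄′(n̄′) ≠ 0`).
* `e2_C_mul` — the `e = 2` clause is invariant under `Ψ ↦ C w · Ψ` for a unit `w` (the rescaling by `W⁻²`).
[cite: Matsumura1987, Thm. 14.2] [cite: ZariskiSamuel1960, Ch. VIII §1 Thm. 1] [folklore]
-/

noncomputable section

-- `Summit.<S>.<S>.…` duplicates the summit name by design (single-problem summit).
set_option linter.dupNamespace false

open IsLocalRing MvPolynomial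
open Literature.AlgebraicGeometry.Resolution
open Summit.ResolutionOfSingularities.ResolutionOfSingularities.Theorems.SwitchingDichotomy.Words

namespace Summit.ResolutionOfSingularities.ResolutionOfSingularities.Theorems.SwitchingDichotomy.ArithTransportFine

/-! ## §1 Ring level -/

section Algebra

variable {S : Type} [CommRing S]

/-- **Re-cleaning into the fine class.** `S` regular local of characteristic `2`, `x ∈ 𝔪 ∖ 𝔪²`, `d` odd, `q ∈ 𝔪^d`, `f = g² + x·q + x²·θ` and
`f − h² ∈ 𝔪^(d+1)` for some `h`: then `θ − δ² ∈ 𝔪^(d−1)` for some `δ`, and `f − (g + x·δ)² − x·q = x²·(θ − δ²)`. Proof: the even tangential normal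
form (`exists_normalForm`, `2e = d + 1`, `A := q + x·θ`, `B := 0`) gives `A′ = A − x·δ² ∈ 𝔪^d`, so `x·(θ − δ²) = A′ − q ∈ 𝔪^d` and `ord x = 1`
(`mem_pow_of_mul_mem_pow_succ`). [cite: ZariskiSamuel1960, Ch. VIII §1 Thm. 1] [folklore] -/
theorem exists_reclean_fine [IsRegularLocalRing S] [CharP S 2] {x : S} (hx : x ∈ maximalIdeal S) (hx2 : x ∉ maximalIdeal S ^ 2)
    {d : ℕ} (hd : Odd d) {f g q θ : S} (hq : q ∈ maximalIdeal S ^ d) (hf : f = g ^ 2 + x * q + x ^ 2 * θ)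
    (hclean : ∃ h : S, f - h ^ 2 ∈ maximalIdeal S ^ (d + 1)) :
    ∃ δ : S, θ - δ ^ 2 ∈ maximalIdeal S ^ (d - 1) ∧ f - (g + x * δ) ^ 2 - x * q = x ^ 2 * (θ - δ ^ 2) := by
  obtain ⟨m, rfl⟩ := hd
  obtain ⟨h, hh⟩ := hclean
  have hf' : f = g ^ 2 + x * (q + x * θ) + 0 := by rw [hf]; ring
  have hh' : f - h ^ 2 ∈ maximalIdeal S ^ (2 * (m + 1)) := by
    rw [show 2 * (m + 1) = 2 * m + 1 + 1 by ring]; exact hh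
  obtain ⟨δ, A', hA', hfA, hA'm, -⟩ :=
    EvenTangentialNormalForm.exists_normalForm (e := m + 1) hx hx2 hf' (Ideal.zero_mem _) hh'
  rw [show 2 * (m + 1) - 1 = 2 * m + 1 by omega] at hA'm
  have hxθ : x * (θ - δ ^ 2) ∈ maximalIdeal S ^ (2 * m + 1) := by
    have e : x * (θ - δ ^ 2) = A' - q := by rw [hA']; ring
    rw [e]
    exact sub_mem hA'm hq
  refine ⟨δ, ?_, ?_⟩
  · rw [show 2 * m + 1 - 1 = 2 * m by omega]
    exact EvenTangentialNormalForm.mem_pow_of_mul_mem_pow_succ hx2 hxθ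
  · rw [hA', add_zero] at hfA
    linear_combination hfA

/-- **The unit-coefficient obstruction** (characteristic `2`): `f = g² + x·A` with `A` a unit and `x ∈ 𝔪 ∖ 𝔪²` gives `f − h² ∉ 𝔪²` for every `h`
(`f − h² = (g − h)² + x·A`: if `g − h ∈ 𝔪` then `x·A ∈ 𝔪²`, i.e. `x ∈ 𝔪²`; else `(g − h)²` is a unit lying in `𝔪`). [folklore] -/
theorem not_sub_sq_mem_sq_of_isUnit [IsLocalRing S] (h2 : (2 : S) = 0) {x : S} (hx : x ∈ maximalIdeal S)
    (hx2 : x ∉ maximalIdeal S ^ 2) {f g A : S} (hA : IsUnit A) (hf : f = g ^ 2 + x * A) (h : S) :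
    f - h ^ 2 ∉ maximalIdeal S ^ 2 := by
  intro hh
  have e : f - h ^ 2 = (g - h) ^ 2 + x * A + 2 * (h * (g - h)) := by rw [hf]; ring
  rw [h2, zero_mul, add_zero] at e
  by_cases hy : g - h ∈ maximalIdeal S
  · have hy2 : (g - h) ^ 2 ∈ maximalIdeal S ^ 2 := Ideal.pow_mem_pow hy 2
    have hxA : x * A ∈ maximalIdeal S ^ 2 := by
      have e' : x * A = (f - h ^ 2) - (g - h) ^ 2 := by rw [e]; ring
      rw [e']
      exact sub_mem hh hy2
    obtain ⟨a, rfl⟩ := hA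
    apply hx2
    have e'' : x = x * (a : S) * (↑a⁻¹ : S) := by rw [mul_assoc, Units.mul_inv, mul_one]
    rw [e'']
    exact Ideal.mul_mem_right _ _ hxA
  · have hu : IsUnit (g - h) := not_not.mp fun hnu => hy ((mem_maximalIdeal _).mpr (mem_nonunits_iff.mpr hnu))
    have hu2 : IsUnit ((g - h) ^ 2) := hu.pow 2
    have hmem : (g - h) ^ 2 ∈ maximalIdeal S := by
      have e' : (g - h) ^ 2 = (f - h ^ 2) - x * A := by rw [e]; ring
      rw [e']
      exact sub_mem (Ideal.pow_le_self two_ne_zero hh) (Ideal.mul_mem_right _ _ hx)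
    exact mem_nonunits_iff.mp ((mem_maximalIdeal _).mp hmem) hu2

/-- **Unit rescaling of the `e = 2` clause**: for a unit `w`, `C w · Ψ` reduces to `c·ℓ^d` iff `Ψ` does. [folklore] -/
theorem e2_C_mul [IsLocalRing S] {d : ℕ} {Ψ : MvPolynomial (Fin 2) S} {w : S} (hw : IsUnit w)
    (hE : ¬ ∃ a b c : ResidueField S, MvPolynomial.map (residue S) Ψ = C c * (C a * X 0 + C b * X 1) ^ d) :
    ¬ ∃ a b c : ResidueField S, MvPolynomial.map (residue S) (C w * Ψ) = C c * (C a * X 0 + C b * X 1) ^ d := by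
  rintro ⟨a, b, c, habc⟩
  have hw' : IsUnit (residue S w) := hw.map _
  obtain ⟨v, hv⟩ := hw'
  refine hE ⟨a, b, (↑v⁻¹ : ResidueField S) * c, ?_⟩
  rw [_root_.map_mul, map_C] at habc
  have e : MvPolynomial.map (residue S) Ψ = C (↑v⁻¹ : ResidueField S) * (C (residue S w) * MvPolynomial.map (residue S) Ψ) := by
    rw [← mul_assoc, ← C_mul, ← hv, Units.inv_mul, C_1, one_mul]
  rw [e, habc, ← mul_assoc, ← C_mul]

end Algebra

/-! ## §2 Run currency -/

section Run

variable {K : Type} [Field K] [CharP K 2]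

/-- **The fine-class B-shape from a raw on-line presentation** (the last line of (F-AB) and of (F-BB) v2): at a stage `j` with `R j` regular, an
r.s.o.p.-part `(x, n₁, n₂)`, a form `Ψ` of ODD degree `d` with the `e = 2` clause, a presentation `s j² = g² + x·Ψ(n₁, n₂) + x²·θ` with `θ : R j`
ARBITRARY, and cleaned order at least `d + 1` (`∃ h, s j² − h² ∈ 𝔪^(d+1)`): then `BinaryBConeE2At R s 2 x d j` — re-clean by
`exists_reclean_fine` (`q := Ψ(n₁, n₂) ∈ 𝔪^d` since `(n₁, n₂)` is an r.s.o.p.-part), keeping `n₁, n₂, Ψ`. [cite: Matsumura1987, Thm. 14.2] [folklore] -/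
theorem binaryBConeE2At_of_presentation {R : ℕ → Subring K} {s : ℕ → K} {j d : ℕ} {x : K}
    (hreg : IsRegularLocalRing (R j)) (hd : Odd d) [hloc : IsLocalRing (R j)] (hx : x ∈ R j) (hs : s j ^ 2 ∈ R j)
    {g n₁ n₂ θ : R j} {Ψ : MvPolynomial (Fin 2) (R j)}
    (hrs : IsRsopPart ![(⟨x, hx⟩ : R j), n₁, n₂]) (hΨ : Ψ.IsHomogeneous d)
    (hf : (⟨s j ^ 2, hs⟩ : R j) = g ^ 2 + ⟨x, hx⟩ * MvPolynomial.eval ![n₁, n₂] Ψ + ⟨x, hx⟩ ^ 2 * θ)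
    (hclean : ∃ h : R j, (⟨s j ^ 2, hs⟩ : R j) - h ^ 2 ∈ maximalIdeal (R j) ^ (d + 1))
    (hE : ¬ ∃ a b c : ResidueField (R j), MvPolynomial.map (residue (R j)) Ψ = C c * (C a * X 0 + C b * X 1) ^ d) :
    BinaryBConeE2At R s 2 x d j := by
  haveI := hreg
  have hn : IsRsopPart ![n₁, n₂] := by
    have h := hrs.comp Fin.succ (Fin.succ_injective _)
    have e : ![(⟨x, hx⟩ : R j), n₁, n₂] ∘ Fin.succ = ![n₁, n₂] := by
      funext i; fin_cases i <;> rfl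
    rwa [e] at h
  have hq : MvPolynomial.eval ![n₁, n₂] Ψ ∈ maximalIdeal (R j) ^ d := ArithTransport.eval_mem_pow_of_isRsopPart hn hΨ
  have hxm : (⟨x, hx⟩ : R j) ∈ maximalIdeal (R j) := hrs.mem_maximalIdeal 0
  have hx2 : (⟨x, hx⟩ : R j) ∉ maximalIdeal (R j) ^ 2 := hrs.not_mem_sq 0
  obtain ⟨δ, hδ, hid⟩ := exists_reclean_fine hxm hx2 hd hq hf hclean
  refine ⟨hloc, hx, hs, g + ⟨x, hx⟩ * δ, n₁, n₂, Ψ, hrs, hΨ, ?_, hE⟩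
  rw [hid]
  exact Ideal.mul_mem_mul (Ideal.mem_span_singleton_self _) hδ

/-- The same with the landing hypothesis in word currency: `HasCleanedOrderAt R s 2 j (d + 1)` (as in (F-AB)/(F-BB)) supplies the cleaner.
[folklore] -/
theorem binaryBConeE2At_of_presentation_of_hasCleanedOrderAt {R : ℕ → Subring K} {s : ℕ → K} {j d : ℕ} {x : K}
    (hreg : IsRegularLocalRing (R j)) (hd : Odd d) [IsLocalRing (R j)] (hx : x ∈ R j) (hs : s j ^ 2 ∈ R j)
    {g n₁ n₂ θ : R j} {Ψ : MvPolynomial (Fin 2) (R j)}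
    (hrs : IsRsopPart ![(⟨x, hx⟩ : R j), n₁, n₂]) (hΨ : Ψ.IsHomogeneous d)
    (hf : (⟨s j ^ 2, hs⟩ : R j) = g ^ 2 + ⟨x, hx⟩ * MvPolynomial.eval ![n₁, n₂] Ψ + ⟨x, hx⟩ ^ 2 * θ)
    (hclean : HasCleanedOrderAt R s 2 j (d + 1))
    (hE : ¬ ∃ a b c : ResidueField (R j), MvPolynomial.map (residue (R j)) Ψ = C c * (C a * X 0 + C b * X 1) ^ d) :
    BinaryBConeE2At R s 2 x d j := by
  obtain ⟨_, hs', ⟨h, hh⟩, -⟩ := hclean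
  exact binaryBConeE2At_of_presentation hreg hd hx hs hrs hΨ hf ⟨h, hh⟩ hE

/-- **No cleaned order `ν ≥ 2` at a stage with a unit coefficient along a regular parameter**: `s j² = g² + x·A`, `A` a unit, `x ∈ 𝔪 ∖ 𝔪²`
⇒ `¬ HasCleanedOrderAt R s 2 j ν` for `2 ≤ ν` (off-line landing points with `Ψ̄′(n̄′) ≠ 0` in (F-AB)/(F-BB)). [folklore] -/
theorem not_hasCleanedOrderAt_of_isUnit {R : ℕ → Subring K} {s : ℕ → K} {j ν : ℕ} {x : K} [IsLocalRing (R j)]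
    (hx : x ∈ R j) (hs : s j ^ 2 ∈ R j) (hxm : (⟨x, hx⟩ : R j) ∈ maximalIdeal (R j)) (hx2 : (⟨x, hx⟩ : R j) ∉ maximalIdeal (R j) ^ 2)
    {g A : R j} (hA : IsUnit A) (hf : (⟨s j ^ 2, hs⟩ : R j) = g ^ 2 + ⟨x, hx⟩ * A) (hν : 2 ≤ ν) :
    ¬ HasCleanedOrderAt R s 2 j ν := by
  rintro ⟨_, hs', ⟨h, hh⟩, -⟩
  have h2 : (2 : R j) = 0 := CharTwo.two_eq_zero
  exact not_sub_sq_mem_sq_of_isUnit h2 hxm hx2 hA hf h (Ideal.pow_le_pow_right hν hh)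

end Run

end Summit.ResolutionOfSingularities.ResolutionOfSingularities.Theorems.SwitchingDichotomy.ArithTransportFine
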